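import Mathlib
import Literature.Analysis.FluidPDE.HardSphereCollisionEnumeration
import Literature.Analysis.FluidPDE.HardSphereFlowJointMeasurable
import Summits.AtomisticToContinuum.HydrodynamicLimit.Theorems.OneFlightGossipEngineOneFlightLayeredChaosWindowEvent
import HarnessLib

/-!
# `OneFlightGossipEngine.OneFlightLayeredChaos` — the `n`-th collision time of a particle is measurable on the
good set, and so is the configuration at that time (crux stmt-AtomisticToContinuum-14535, helper for every line)

`Φ.nthCollisionTimeOf k n z = (nextTimeAfter S)^[n+1] 0` with `S` = the collision times of `k` along the orbit of
`z`, `nextTimeAfter S x = sInf (S ∩ (x, ∞))` (junk `0` when empty). On the good set `S` is locally finite, so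
`nextTimeAfter S (T z) ≤ c` iff "some collision of `k` in `(T z, c]`" or "no collision after `T z` and `0 ≤ c`" —
countable Boolean combinations of the events "collision of `k` in `[q, c]`" (measurable on the good set:
`measurableSet_good_inter_exists_participates_Icc`, file `…WindowEvent`) and `{T < q}`. Induction on `n` gives
measurability of `z ↦ Φ.nthCollisionTimeOf k n z` on `Φ.good`; joint measurability of the flow on `Φ.good × ℝ`
(`HardSphereFlow.measurable_flow_prod_torus`) then gives measurability of `z ↦ Φ_{t_n(z)} z` there. No new definitions.
-/

open MeasureTheory Set Filter Topology
open Literature.Analysis.FluidPDE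

namespace Summit.AtomisticToContinuum.HydrodynamicLimit.Theorems

variable {d : Type*} [Fintype d] {N : ℕ} {ε : ℝ}

/-- On a good orbit: `nextTimeAfter S x ≤ c` (with `S` the collision times of `k`) iff there is a collision of `k`
in `(x, c]`, or there is none after `x` and `0 ≤ c` (the junk value `sInf ∅ = 0`). [folklore] -/
theorem nextTimeAfter_collisionTimesOf_le_iff (Φ : HardSphereFlow (Torus.geometry d) ε N) (k : Fin N)
    {z : Config N d (UnitAddTorus d)} (hz : z ∈ Φ.good) (x c : ℝ) :
    nextTimeAfter (collisionTimesOf (Torus.geometry d) ε (fun t => Φ.flow t z) k) x ≤ c ↔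
      (∃ s, Participates (Torus.geometry d) ε (Φ.flow s z) k ∧ x < s ∧ s ≤ c) ∨
        ((∀ s, Participates (Torus.geometry d) ε (Φ.flow s z) k → s ≤ x) ∧ 0 ≤ c) := by
  set S := collisionTimesOf (Torus.geometry d) ε (fun t => Φ.flow t z) k with hS
  have hfin : ∀ b, (S ∩ Ioc x b).Finite := fun b =>
    (Φ.isTrajectory z hz).finite_collisionTimesOf_inter_Ioc k x b
  by_cases hne : (S ∩ Ioi x).Nonempty
  · have hleast := isLeast_nextTimeAfter hfin hne
    constructor
    · intro h
      exact Or.inl ⟨_, hleast.1.1, hleast.1.2, h⟩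
    · rintro (⟨s, hs, hxs, hsc⟩ | ⟨hall, _⟩)
      · exact (hleast.2 ⟨hs, hxs⟩).trans hsc
      · obtain ⟨s, hs, hxs⟩ := hne
        exact absurd (hall s hs) (not_le.2 hxs)
  · have hempty : S ∩ Ioi x = ∅ := not_nonempty_iff_eq_empty.1 hne
    rw [nextTimeAfter_of_eq_empty hempty]
    constructor
    · intro h
      refine Or.inr ⟨fun s hs => ?_, h⟩
      by_contra hxs
      exact hne ⟨s, hs, not_le.1 hxs⟩
    · rintro (⟨s, hs, hxs, _⟩ | ⟨_, h⟩)
      · exact absurd ⟨s, hs, hxs⟩ hne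
      · exact h

/-- Measurability on the good set is preserved by `z ↦ nextTimeAfter (collision times of k) (T z)`: if all the
events `Φ.good ∩ {T ≤ c}` are measurable then so are all `Φ.good ∩ {nextTimeAfter S (T ·) ≤ c}`. [folklore] -/
theorem measurableSet_good_inter_nextTimeAfter_le (Φ : HardSphereFlow (Torus.geometry d) ε N) (k : Fin N)
    {T : Config N d (UnitAddTorus d) → ℝ}
    (hT : ∀ c : ℝ, MeasurableSet (Φ.good ∩ {z | T z ≤ c})) (c : ℝ) :
    MeasurableSet (Φ.good ∩ {z : Config N d (UnitAddTorus d) |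
      nextTimeAfter (collisionTimesOf (Torus.geometry d) ε (fun t => Φ.flow t z) k) (T z) ≤ c}) := by
  -- building blocks
  have hlt : ∀ q : ℝ, MeasurableSet (Φ.good ∩ {z | T z < q}) := by
    intro q
    have : Φ.good ∩ {z | T z < q} = ⋃ n : ℕ, (Φ.good ∩ {z | T z ≤ q - 1 / ((n : ℝ) + 1)}) := by
      ext z
      simp only [mem_inter_iff, mem_setOf_eq, mem_iUnion]
      constructor
      · rintro ⟨hz, h⟩
        obtain ⟨n, hn⟩ := exists_nat_one_div_lt (sub_pos.2 h)
        exact ⟨n, hz, by linarith⟩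
      · rintro ⟨n, hz, h⟩
        have : (0 : ℝ) < 1 / ((n : ℝ) + 1) := by positivity
        exact ⟨hz, by linarith⟩
    rw [this]
    exact MeasurableSet.iUnion fun n => hT _
  have hIcc : ∀ a b : ℝ, MeasurableSet (Φ.good ∩ {z : Config N d (UnitAddTorus d) |
      ∃ t ∈ Icc a b, Participates (Torus.geometry d) ε (Φ.flow t z) k}) :=
    fun a b => measurableSet_good_inter_exists_participates_Icc Φ k a b
  -- "a collision of k in (T z, b]"
  have hafter : ∀ b : ℝ, MeasurableSet (Φ.good ∩ {z : Config N d (UnitAddTorus d) |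
      ∃ s, Participates (Torus.geometry d) ε (Φ.flow s z) k ∧ T z < s ∧ s ≤ b}) := by
    intro b
    have : Φ.good ∩ {z : Config N d (UnitAddTorus d) |
        ∃ s, Participates (Torus.geometry d) ε (Φ.flow s z) k ∧ T z < s ∧ s ≤ b} =
      ⋃ q : ℚ, ((Φ.good ∩ {z | T z < q}) ∩ (Φ.good ∩ {z : Config N d (UnitAddTorus d) |
        ∃ t ∈ Icc (q : ℝ) b, Participates (Torus.geometry d) ε (Φ.flow t z) k})) := by
      ext z
      simp only [mem_inter_iff, mem_setOf_eq, mem_iUnion]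
      constructor
      · rintro ⟨hz, s, hs, hTs, hsb⟩
        obtain ⟨q, hq1, hq2⟩ := exists_rat_btwn hTs
        exact ⟨q, ⟨hz, hq1⟩, hz, s, ⟨hq2.le, hsb⟩, hs⟩
      · rintro ⟨q, ⟨hz, hq⟩, _, s, ⟨hqs, hsb⟩, hs⟩
        exact ⟨hz, s, hs, hq.trans_le hqs, hsb⟩
    rw [this]
    exact MeasurableSet.iUnion fun q => (hlt q).inter (hIcc q b)
  -- "no collision of k after T z"
  have hnone : MeasurableSet (Φ.good ∩ {z : Config N d (UnitAddTorus d) |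
      ∀ s, Participates (Torus.geometry d) ε (Φ.flow s z) k → s ≤ T z}) := by
    have : Φ.good ∩ {z : Config N d (UnitAddTorus d) |
        ∀ s, Participates (Torus.geometry d) ε (Φ.flow s z) k → s ≤ T z} =
      Φ.good \ ⋃ K : ℕ, (Φ.good ∩ {z : Config N d (UnitAddTorus d) |
        ∃ s, Participates (Torus.geometry d) ε (Φ.flow s z) k ∧ T z < s ∧ s ≤ (K : ℝ)}) := by
      ext z
      simp only [mem_inter_iff, mem_setOf_eq, Set.mem_sdiff, mem_iUnion, not_exists, not_and, not_le]
      constructor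
      · rintro ⟨hz, hall⟩
        refine ⟨hz, fun K _ s hs hTs => ?_⟩
        exact absurd (hall s hs) (not_le.2 hTs)
      · rintro ⟨hz, hno⟩
        refine ⟨hz, fun s hs => ?_⟩
        by_contra hTs
        obtain ⟨K, hK⟩ := exists_nat_ge s
        exact lt_irrefl (K : ℝ) ((hno K hz s hs (not_le.1 hTs)).trans_le hK)
    rw [this]
    exact Φ.measurableSet_good.diff (MeasurableSet.iUnion fun K => hafter K)
  -- assemble
  have hrepr : Φ.good ∩ {z : Config N d (UnitAddTorus d) |
      nextTimeAfter (collisionTimesOf (Torus.geometry d) ε (fun t => Φ.flow t z) k) (T z) ≤ c} =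
    (Φ.good ∩ {z : Config N d (UnitAddTorus d) |
        ∃ s, Participates (Torus.geometry d) ε (Φ.flow s z) k ∧ T z < s ∧ s ≤ c}) ∪
      ((Φ.good ∩ {z : Config N d (UnitAddTorus d) |
        ∀ s, Participates (Torus.geometry d) ε (Φ.flow s z) k → s ≤ T z}) ∩ {_z | 0 ≤ c}) := by
    ext z
    simp only [mem_inter_iff, mem_setOf_eq, mem_union]
    constructor
    · rintro ⟨hz, h⟩
      rcases (nextTimeAfter_collisionTimesOf_le_iff Φ k hz (T z) c).1 h with h1 | ⟨h2, h3⟩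
      · exact Or.inl ⟨hz, h1⟩
      · exact Or.inr ⟨⟨hz, h2⟩, h3⟩
    · rintro (⟨hz, h1⟩ | ⟨⟨hz, h2⟩, h3⟩)
      · exact ⟨hz, (nextTimeAfter_collisionTimesOf_le_iff Φ k hz (T z) c).2 (Or.inl h1)⟩
      · exact ⟨hz, (nextTimeAfter_collisionTimesOf_le_iff Φ k hz (T z) c).2 (Or.inr ⟨h2, h3⟩)⟩
  rw [hrepr]
  refine (hafter c).union (hnone.inter ?_)
  by_cases hc : 0 ≤ c
  · have : {_z : Config N d (UnitAddTorus d) | 0 ≤ c} = univ := eq_univ_of_forall fun _ => hc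
    rw [this]; exact MeasurableSet.univ
  · have : {_z : Config N d (UnitAddTorus d) | 0 ≤ c} = ∅ := eq_empty_of_forall_notMem fun _ h => hc h
    rw [this]; exact MeasurableSet.empty

/-- **The `n`-th collision time of `k` is measurable on the good set** (all sublevel events). [folklore] -/
theorem measurableSet_good_inter_nthCollisionTimeOf_le (Φ : HardSphereFlow (Torus.geometry d) ε N)
    (k : Fin N) (n : ℕ) :
    ∀ c : ℝ, MeasurableSet (Φ.good ∩ {z : Config N d (UnitAddTorus d) | Φ.nthCollisionTimeOf k n z ≤ c}) := by
  induction n with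
  | zero =>
    intro c
    have h0 : ∀ c' : ℝ, MeasurableSet (Φ.good ∩ {_z : Config N d (UnitAddTorus d) | (0 : ℝ) ≤ c'}) := by
      intro c'
      by_cases hc' : (0 : ℝ) ≤ c'
      · have : Φ.good ∩ {_z : Config N d (UnitAddTorus d) | (0 : ℝ) ≤ c'} = Φ.good :=
          inter_eq_left.2 fun _ _ => hc'
        rw [this]; exact Φ.measurableSet_good
      · have : Φ.good ∩ {_z : Config N d (UnitAddTorus d) | (0 : ℝ) ≤ c'} = ∅ :=
          eq_empty_of_forall_notMem fun _ h => hc' h.2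
        rw [this]; exact MeasurableSet.empty
    have h := measurableSet_good_inter_nextTimeAfter_le Φ k (T := fun _ => (0 : ℝ)) h0 c
    have hset : Φ.good ∩ {z : Config N d (UnitAddTorus d) | Φ.nthCollisionTimeOf k 0 z ≤ c} =
        Φ.good ∩ {z : Config N d (UnitAddTorus d) |
          nextTimeAfter (collisionTimesOf (Torus.geometry d) ε (fun t => Φ.flow t z) k) 0 ≤ c} := rfl
    rw [hset]; exact h
  | succ n ih =>
    intro c
    have h := measurableSet_good_inter_nextTimeAfter_le Φ k (T := fun z => Φ.nthCollisionTimeOf k n z) ih c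
    have hset : Φ.good ∩ {z : Config N d (UnitAddTorus d) | Φ.nthCollisionTimeOf k (n + 1) z ≤ c} =
        Φ.good ∩ {z : Config N d (UnitAddTorus d) |
          nextTimeAfter (collisionTimesOf (Torus.geometry d) ε (fun t => Φ.flow t z) k)
            (Φ.nthCollisionTimeOf k n z) ≤ c} := by
      ext z
      simp only [mem_inter_iff, mem_setOf_eq]
      rw [show Φ.nthCollisionTimeOf k (n + 1) z = nextTimeAfter
          (collisionTimesOf (Torus.geometry d) ε (fun t => Φ.flow t z) k) (Φ.nthCollisionTimeOf k n z) from
        nthTimeAfter_succ _ _ _]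
    rw [hset]; exact h

/-- The `n`-th collision time of `k`, restricted to the good set, is a measurable function. [folklore] -/
theorem measurable_nthCollisionTimeOf_restrict (Φ : HardSphereFlow (Torus.geometry d) ε N) (k : Fin N) (n : ℕ) :
    Measurable fun z : Φ.good => Φ.nthCollisionTimeOf k n (z : Config N d (UnitAddTorus d)) := by
  refine measurable_of_Iic fun c => ?_
  have : (fun z : Φ.good => Φ.nthCollisionTimeOf k n (z : Config N d (UnitAddTorus d))) ⁻¹' Iic c =
      Subtype.val ⁻¹' (Φ.good ∩ {z : Config N d (UnitAddTorus d) | Φ.nthCollisionTimeOf k n z ≤ c}) := by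
    ext z
    simp only [mem_preimage, mem_Iic, mem_inter_iff, mem_setOf_eq, Subtype.coe_prop, true_and]
  rw [this]
  exact measurable_subtype_coe (measurableSet_good_inter_nthCollisionTimeOf_le Φ k n c)

/-- **The configuration at the `n`-th collision time of `k` is measurable on the good set** (joint measurability
of the flow on `Φ.good × ℝ`). [folklore] -/
theorem measurable_flow_nthCollisionTimeOf_restrict : ∀ {d : Type*} [Fintype d] {N : ℕ} {ε : ℝ} (Φ : Literature.Analysis.FluidPDE.HardSphereFlow (Literature.Analysis.FluidPDE.Torus.geometry d) ε N) (k : Fin N) (n : ℕ), Measurable fun z : Φ.good => Φ.flow (Φ.nthCollisionTimeOf k n (z : Literature.Analysis.FluidPDE.Config N d (UnitAddTorus d))) (z : Literature.Analysis.FluidPDE.Config N d (UnitAddTorus d)) := by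
  intro d _ N ε Φ k n
  exact Φ.measurable_flow_prod_torus.comp (measurable_id.prodMk (measurable_nthCollisionTimeOf_restrict Φ k n))

end Summit.AtomisticToContinuum.HydrodynamicLimit.Theorems
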